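/-
Copyright (c) 2026 the pub-hodgecm-mathlib formalisation cell (harness21).  Prover seat hodgecm-mathlib-F0P3a-p01 (g16): road «S3-ram» (LEAD F0P3a-plan (g12); architect
A-p16 (g31) 22:49:18Z «(a2) SHELL SUMS → p01», 23:00:18Z «type the top layer at the κ-signed level as a character sum»), organ A′ (ii) (a2) part (C2); 2026-09-01.
-/
import Mathlib
import HarnessLib

/-!
# The depth-zero κ-transfer at a tame-ramified place, type (1): the ROOT CHARACTER SUMS (organ A′ (ii) (a2), part (C2) — finite-field algebra)

Topic `NumberTheory/Rogawski1990`; namespace `Literature.NumberTheory.Rogawski1990`.  THEOREMS ONLY (no definition, no instance, no notation, no named fact, no `sorry`);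
kernel lane `--supports stmt-HodgeConjecture-24833`.  Cell `pub/hodgecm-mathlib`, crux H413; road «S3-ram» (Literature seeding, count-neutral), P-1-ram skeleton organ A′ (ii)
(architect A-p16 (g31)), deal (a2) «SHELL SUMS», part (C2) «EQUILATERAL ROOT LAW» of the design memo `F0/P3a/F0P3a-p01/g16/rootbook/DESIGN-a2C-RootBookkeeping.v1…md`
(bc8b04ba; ref5 R-269 «=», A-p16 23:00:18Z).

THE MATHEMATICS.  At the common root `L₀` of the four ramified type-(1) literals `t_b` (equilateral configuration `N₁ = N₂ = N = 2k+1`; eigen-coordinates `(α, u, γ)`; residual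
form of the literal `b`: `h̄_b = diag(d₀, d₁, d₂)` with `(d₀, d₁, d₂) = (ε^{b_α}u₀, ε^{b_u}u₁, ε^{b_α+b_u}u₂)`, `ε` a non-square; leading term of `π^{−d₀}(t−1)` after the scalar
translation `y_u ↦ 0`: `Ȳ = diag(2A, 0, 2C)`, `A, C, A − C ≠ 0`), the `(q+1)q` children of the root sit `q` at a time over the ISOTROPIC POINTS `x̄` of the conic `h̄_b(x̄,x̄) = 0`, and a
child has the even-depth rank-two label `E_k` iff `Q_b(x̄) := h̄_b(x̄, Ȳx̄) = 0`, else the rank-one label `P^{±}_{k−1}` (★ p847102 `v_childFrame_conj_le_iff_of_le`, F0P2-p01).  No null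
isotropic point has `x_α = 0` (§2 `eq_zero_of_rootNull_of_apply_zero_eq_zero`), and in the affine chart `x_α = 1`, `(s, r) = (x_u, x_γ)`, the null isotropic points are EXACTLY the product set
`{s : (d₁Cs)² = d₀d₁C(A−C)} × {r : (d₂Cr)² = −d₀d₂AC}` (§2 `filter_rootNull_eq_product`), whence
  **`#{null points of literal b} = (χ(d₀d₁C(A−C)) + 1)·(χ(−d₀d₂AC) + 1) ∈ {0, 2, 4}`** (§2 `card_rootNull`, `χ = quadraticChar k`),
and over the four twists (`χ(ε) = −1`; `κ_b = (−1)^{b_u}`):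
  **`Σ_b #{null}_b = 4`**,   **`Σ_b κ_b·#{null}_b = 4·χ(−u₀u₂AC)`**   (§3 `sum_card_rootNull_twists`, `signedSum_card_rootNull_twists`)
— the κ-signed top-layer contribution is a LEGENDRE SYMBOL OF THE PRODUCT OF THE LEADING COEFFICIENTS of the two eigenvalue differences `y_α − y_u`, `y_γ − y_u` (times `χ(−u₀u₂)`:
ONE global constant): Rogawski's `τ` (CERT smoke v1.1).  With ★ p847094's tails this gives `Σ_b κ_b n_{b,j} = ±4q·(S(E_k) − S(P_{k−1}))_j` in the class-blind slots, i.e. the certificate's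
`(X̃_bd, X̃_reg, X̃_0) = ±4·(q^k, q^{k−1}, (q^k−1)∕((q−1)q²))` for every `k` (memo §1).  Certificate rows: q = 3 (3,3,3)∕(5,5,5): one literal with 4 null points, three with 0; q = 5 (3,3,3):
4 + 0 + 0 + 0 (A-p16 23:00:18Z, roothist).  HONEST LABEL: HC_CM is proved only modulo the 2 remaining named inputs (hLiu418 24832, h413 24833) until rung 0 closes; this file is
finite-field algebra and asserts nothing printed.

* §1 `card_filter_mul_sq_eq` — `#{x : (c·x)² = a} = χ(a) + 1` (`c ≠ 0`; Mathlib `quadraticChar_card_sqrts`).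
* §2 `eq_zero_of_rootNull_of_apply_zero_eq_zero`, `filter_rootNull_eq_product`, **`card_rootNull`**.
* §3 `twist_sum_four`, `twist_signedSum_four` (ring identities), **`sum_card_rootNull_twists`**, **`signedSum_card_rootNull_twists`**.

## References
* [Rogawski1990] J. D. Rogawski, *Automorphic Representations of Unitary Groups in Three Variables*, Ann. of Math. Stud. 123 (1990), §4.9 Prop. 4.9.1 (a)(b) p. 55; §12.2.
* [LabesseLanglands1979] J.-P. Labesse, R. P. Langlands, *L-indistinguishability for SL(2)*, Canad. J. Math. 31 (1979), §5 (κ-signs over the four classes).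
* [IrelandRosen1990] K. Ireland, M. Rosen, *A Classical Introduction to Modern Number Theory*, GTM 84, Ch. 8 §1–§2 (numbers of solutions of `x² = a` via the quadratic character).
-/

set_option autoImplicit false

namespace Literature.NumberTheory.Rogawski1990

open Finset

variable {k : Type*} [Field k] [Fintype k] [DecidableEq k]

/-! ## §1 Square roots counted by the quadratic character -/

/-- `#{x : (c·x)² = a} = χ(a) + 1` for `c ≠ 0` (substitute `w = c·x` in Mathlib's `quadraticChar_card_sqrts`). [cite: IrelandRosen1990, Ch. 8 §1] -/
theorem card_filter_mul_sq_eq (hk : ringChar k ≠ 2) {c : k} (hc : c ≠ 0) (a : k) :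
    ((univ.filter fun x : k => (c * x) ^ 2 = a).card : ℤ) = quadraticChar k a + 1 := by
  have hset : ({x : k | x ^ 2 = a} : Set k).toFinset = univ.filter fun w : k => w ^ 2 = a := by
    ext w; simp
  have hcard : (univ.filter fun x : k => (c * x) ^ 2 = a).card = (univ.filter fun w : k => w ^ 2 = a).card := by
    refine card_nbij' (fun x => c * x) (fun w => c⁻¹ * w) (fun x hx => ?_) (fun w hw => ?_) (fun x _ => ?_) (fun w _ => ?_)
    · rw [mem_coe, mem_filter] at hx ⊢; exact ⟨mem_univ _, hx.2⟩
    · rw [mem_coe, mem_filter] at hw ⊢; refine ⟨mem_univ _, ?_⟩; rw [mul_inv_cancel_left₀ hc]; exact hw.2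
    · exact inv_mul_cancel_left₀ hc x
    · exact mul_inv_cancel_left₀ hc w
  rw [hcard, ← hset]
  exact quadraticChar_card_sqrts hk a

/-! ## §2 The null isotropic points of one literal: a product set in the chart `x_α = 1` -/

section OneLiteral

variable {d₀ d₁ d₂ A C : k}

omit [Fintype k] [DecidableEq k] in
/-- No null isotropic point has `x_α = 0`: `d₀Ax_α² + d₂Cx_γ² = 0`, `Σ d_i x_i² = 0`, `x_α = 0` force `x = 0` (`d₁, d₂, C ≠ 0`). [cite: Rogawski1990, §4.9 p. 54] -/
theorem eq_zero_of_rootNull_of_apply_zero_eq_zero (hd₁ : d₁ ≠ 0) (hd₂ : d₂ ≠ 0) (hC : C ≠ 0) {x : Fin 3 → k}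
    (hiso : d₀ * x 0 ^ 2 + d₁ * x 1 ^ 2 + d₂ * x 2 ^ 2 = 0) (hnull : d₀ * A * x 0 ^ 2 + d₂ * C * x 2 ^ 2 = 0) (h0 : x 0 = 0) : x = 0 := by
  have h2 : x 2 = 0 := by
    rw [h0] at hnull
    have : d₂ * C * x 2 ^ 2 = 0 := by linear_combination hnull
    simpa [hd₂, hC] using this
  have h1 : x 1 = 0 := by
    rw [h0, h2] at hiso
    have : d₁ * x 1 ^ 2 = 0 := by linear_combination hiso
    simpa [hd₁] using this
  ext i; fin_cases i <;> simp [h0, h1, h2]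

/-- **In the chart `x_α = 1` the null isotropic points form a PRODUCT SET**: `{(s,r) : d₀ + d₁s² + d₂r² = 0 ∧ d₀A + d₂Cr² = 0} = {s : (d₁Cs)² = d₀d₁C(A−C)} × {r : (d₂Cr)² = −d₀d₂AC}`
(`d₁, d₂, C ≠ 0`). [cite: Rogawski1990, §4.9 p. 54] [cite: IrelandRosen1990, Ch. 8 §2] -/
theorem filter_rootNull_eq_product (hd₁ : d₁ ≠ 0) (hd₂ : d₂ ≠ 0) (hC : C ≠ 0) :
    (univ.filter fun p : k × k => d₀ + d₁ * p.1 ^ 2 + d₂ * p.2 ^ 2 = 0 ∧ d₀ * A + d₂ * C * p.2 ^ 2 = 0) =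
      (univ.filter fun s : k => (d₁ * C * s) ^ 2 = d₀ * d₁ * C * (A - C)) ×ˢ (univ.filter fun r : k => (d₂ * C * r) ^ 2 = -(d₀ * d₂ * A * C)) := by
  ext ⟨s, r⟩
  simp only [mem_filter, mem_univ, true_and, mem_product]
  constructor
  · rintro ⟨hiso, hnull⟩
    refine ⟨?_, ?_⟩
    · -- `d₁ s² = −d₀ − d₂ r²` and `d₂ r² = −d₀ A ∕ C`
      linear_combination d₁ * C ^ 2 * hiso - d₁ * C * hnull
    · linear_combination d₂ * C * hnull
  · rintro ⟨hs, hr⟩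
    have hr' : d₂ * C * (d₀ * A + d₂ * C * r ^ 2) = 0 := by linear_combination hr
    have hnull : d₀ * A + d₂ * C * r ^ 2 = 0 := by
      rcases mul_eq_zero.1 hr' with h | h
      · exact absurd h (mul_ne_zero hd₂ hC)
      · exact h
    refine ⟨?_, hnull⟩
    have hs' : d₁ * C * (C * (d₀ + d₁ * s ^ 2 + d₂ * r ^ 2)) = 0 := by linear_combination hs + d₁ * C * hnull
    rcases mul_eq_zero.1 hs' with h | h
    · exact absurd h (mul_ne_zero hd₁ hC)
    · rcases mul_eq_zero.1 h with h' | h'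
      · exact absurd h' hC
      · exact h'

/-- **THE NULL-POINT COUNT OF ONE LITERAL**: `#{(s,r) : d₀ + d₁s² + d₂r² = 0 ∧ d₀A + d₂Cr² = 0} = (χ(d₀d₁C(A−C)) + 1)·(χ(−d₀d₂AC) + 1)` (`d₁, d₂, C ≠ 0`, `char k ≠ 2`):
the number of isotropic points of `diag(d₀,d₁,d₂)` on which the root's leading form `diag(d₀A, 0, d₂C)` vanishes — each carries `q` children of label `E_k`. [cite: Rogawski1990, §4.9 Prop. 4.9.1 (b) p. 55]
[cite: IrelandRosen1990, Ch. 8 §2] -/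
theorem card_rootNull (hk : ringChar k ≠ 2) (hd₁ : d₁ ≠ 0) (hd₂ : d₂ ≠ 0) (hC : C ≠ 0) :
    ((univ.filter fun p : k × k => d₀ + d₁ * p.1 ^ 2 + d₂ * p.2 ^ 2 = 0 ∧ d₀ * A + d₂ * C * p.2 ^ 2 = 0).card : ℤ) =
      (quadraticChar k (d₀ * d₁ * C * (A - C)) + 1) * (quadraticChar k (-(d₀ * d₂ * A * C)) + 1) := by
  rw [filter_rootNull_eq_product hd₁ hd₂ hC, card_product, Nat.cast_mul,
    card_filter_mul_sq_eq hk (mul_ne_zero hd₁ hC), card_filter_mul_sq_eq hk (mul_ne_zero hd₂ hC)]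

end OneLiteral

/-! ## §3 The four twists: total and κ-signed sums -/

/-- `Σ_b (1 + (−1)^{b_u}a)(1 + (−1)^{b_α+b_u}c) = 4`. [cite: LabesseLanglands1979, §5] -/
theorem twist_sum_four {R : Type*} [CommRing R] (a c : R) :
    (1 + a) * (1 + c) + (1 - a) * (1 - c) + (1 + a) * (1 - c) + (1 - a) * (1 + c) = 4 := by ring

/-- `Σ_b (−1)^{b_u}(1 + (−1)^{b_u}a)(1 + (−1)^{b_α+b_u}c) = 4a`. [cite: LabesseLanglands1979, §5] -/
theorem twist_signedSum_four {R : Type*} [CommRing R] (a c : R) :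
    (1 + a) * (1 + c) - (1 - a) * (1 - c) + (1 + a) * (1 - c) - (1 - a) * (1 + c) = 4 * a := by ring

section Twists

variable {u₀ u₁ u₂ ε A C : k}

/-- The twisted characters: `χ(d₀d₁C(A−C))` and `χ(−d₀d₂AC)` at the twist `(d₀,d₁,d₂) = (ε^{i}u₀, ε^{j}u₁, ε^{i+j}u₂)` in terms of the untwisted ones (`χ(ε) = −1`).
[cite: IrelandRosen1990, Ch. 8 §1] -/
theorem quadraticChar_twist (hε : quadraticChar k ε = -1) (i j : ℕ) :
    quadraticChar k (ε ^ i * u₀ * (ε ^ j * u₁) * C * (A - C)) = (-1) ^ (i + j) * quadraticChar k (u₀ * u₁ * C * (A - C)) ∧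
    quadraticChar k (-(ε ^ i * u₀ * (ε ^ (i + j) * u₂) * A * C)) = (-1) ^ j * quadraticChar k (-(u₀ * u₂ * A * C)) := by
  have hpow : ∀ n : ℕ, quadraticChar k (ε ^ n) = (-1) ^ n := fun n => by rw [map_pow, hε]
  constructor
  · rw [show ε ^ i * u₀ * (ε ^ j * u₁) * C * (A - C) = ε ^ (i + j) * (u₀ * u₁ * C * (A - C)) by ring, map_mul, hpow]
  · rw [show -(ε ^ i * u₀ * (ε ^ (i + j) * u₂) * A * C) = ε ^ (2 * i + j) * (-(u₀ * u₂ * A * C)) by ring, map_mul, hpow, pow_add, pow_mul]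
    simp

/-- **THE FOUR LITERALS TOGETHER: `Σ_b #{null}_b = 4`** (twists `(ε^{b_α}u₀, ε^{b_u}u₁, ε^{b_α+b_u}u₂)`, `b ∈ {0,1}²`). [cite: LabesseLanglands1979, §5] [cite: Rogawski1990, §4.9 Prop. 4.9.1 (b) p. 55] -/
theorem sum_card_rootNull_twists (hk : ringChar k ≠ 2) (hε : quadraticChar k ε = -1) (hu₁ : u₁ ≠ 0) (hu₂ : u₂ ≠ 0) (hC : C ≠ 0) :
    (∑ b : Fin 2 × Fin 2, ((univ.filter fun p : k × k =>
        ε ^ (b.1 : ℕ) * u₀ + ε ^ (b.2 : ℕ) * u₁ * p.1 ^ 2 + ε ^ ((b.1 : ℕ) + b.2) * u₂ * p.2 ^ 2 = 0 ∧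
        ε ^ (b.1 : ℕ) * u₀ * A + ε ^ ((b.1 : ℕ) + b.2) * u₂ * C * p.2 ^ 2 = 0).card : ℤ)) = 4 := by
  have hε0 : ε ≠ 0 := by rintro rfl; rw [MulChar.map_zero] at hε; norm_num at hε
  have hb : ∀ b : Fin 2 × Fin 2, ((univ.filter fun p : k × k =>
        ε ^ (b.1 : ℕ) * u₀ + ε ^ (b.2 : ℕ) * u₁ * p.1 ^ 2 + ε ^ ((b.1 : ℕ) + b.2) * u₂ * p.2 ^ 2 = 0 ∧
        ε ^ (b.1 : ℕ) * u₀ * A + ε ^ ((b.1 : ℕ) + b.2) * u₂ * C * p.2 ^ 2 = 0).card : ℤ) =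
      ((-1) ^ ((b.1 : ℕ) + b.2) * quadraticChar k (u₀ * u₁ * C * (A - C)) + 1) * ((-1) ^ (b.2 : ℕ) * quadraticChar k (-(u₀ * u₂ * A * C)) + 1) := by
    intro b
    rw [card_rootNull hk (mul_ne_zero (pow_ne_zero _ hε0) hu₁) (mul_ne_zero (pow_ne_zero _ hε0) hu₂) hC]
    obtain ⟨h1, h2⟩ := quadraticChar_twist (u₀ := u₀) (u₁ := u₁) (u₂ := u₂) (A := A) (C := C) hε (b.1 : ℕ) (b.2 : ℕ)
    rw [h1, h2]
  simp only [hb, Fintype.sum_prod_type, Fin.sum_univ_two, Fin.val_zero, Fin.val_one]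
  have := twist_sum_four (quadraticChar k (-(u₀ * u₂ * A * C)) : ℤ) (quadraticChar k (u₀ * u₁ * C * (A - C)))
  linear_combination this

/-- **THE κ-SIGNED SUM: `Σ_b κ_b·#{null}_b = 4·χ(−u₀u₂AC)`**, `κ_b = (−1)^{b_u}` — the Legendre symbol of the product of the leading coefficients of `y_α − y_u` and
`y_γ − y_u` (up to the constant `χ(−u₀u₂)`): Rogawski's `τ`. [cite: LabesseLanglands1979, §5] [cite: Rogawski1990, §4.9 Prop. 4.9.1 (b) p. 55; §12.2] -/
theorem signedSum_card_rootNull_twists (hk : ringChar k ≠ 2) (hε : quadraticChar k ε = -1) (hu₁ : u₁ ≠ 0) (hu₂ : u₂ ≠ 0) (hC : C ≠ 0) :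
    (∑ b : Fin 2 × Fin 2, (-1 : ℤ) ^ (b.2 : ℕ) * ((univ.filter fun p : k × k =>
        ε ^ (b.1 : ℕ) * u₀ + ε ^ (b.2 : ℕ) * u₁ * p.1 ^ 2 + ε ^ ((b.1 : ℕ) + b.2) * u₂ * p.2 ^ 2 = 0 ∧
        ε ^ (b.1 : ℕ) * u₀ * A + ε ^ ((b.1 : ℕ) + b.2) * u₂ * C * p.2 ^ 2 = 0).card : ℤ)) = 4 * quadraticChar k (-(u₀ * u₂ * A * C)) := by
  have hε0 : ε ≠ 0 := by rintro rfl; rw [MulChar.map_zero] at hε; norm_num at hε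
  have hb : ∀ b : Fin 2 × Fin 2, ((univ.filter fun p : k × k =>
        ε ^ (b.1 : ℕ) * u₀ + ε ^ (b.2 : ℕ) * u₁ * p.1 ^ 2 + ε ^ ((b.1 : ℕ) + b.2) * u₂ * p.2 ^ 2 = 0 ∧
        ε ^ (b.1 : ℕ) * u₀ * A + ε ^ ((b.1 : ℕ) + b.2) * u₂ * C * p.2 ^ 2 = 0).card : ℤ) =
      ((-1) ^ ((b.1 : ℕ) + b.2) * quadraticChar k (u₀ * u₁ * C * (A - C)) + 1) * ((-1) ^ (b.2 : ℕ) * quadraticChar k (-(u₀ * u₂ * A * C)) + 1) := by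
    intro b
    rw [card_rootNull hk (mul_ne_zero (pow_ne_zero _ hε0) hu₁) (mul_ne_zero (pow_ne_zero _ hε0) hu₂) hC]
    obtain ⟨h1, h2⟩ := quadraticChar_twist (u₀ := u₀) (u₁ := u₁) (u₂ := u₂) (A := A) (C := C) hε (b.1 : ℕ) (b.2 : ℕ)
    rw [h1, h2]
  simp only [hb, Fintype.sum_prod_type, Fin.sum_univ_two, Fin.val_zero, Fin.val_one]
  have := twist_signedSum_four (quadraticChar k (-(u₀ * u₂ * A * C)) : ℤ) (quadraticChar k (u₀ * u₁ * C * (A - C)))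
  linear_combination this

end Twists

end Literature.NumberTheory.Rogawski1990
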